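import Literature.Algebra.Homology.CechUniverseLift
import Literature.AlgebraicGeometry.Motives.EtaleToProetLeray
import HarnessLib

/-!
# Bhatt–Scholze Cor. 5.1.6, input (B) proved: `Hᵖ(X_ét, ulift I) = 0` for injective `I`

`EtaleToProetLeray.lean` reduces the pro-étale/étale comparison
`nonempty_addEquiv_sheafH_etaleToProetPullback` (Bhatt–Scholze Cor. 5.1.6) and the `lim¹` sequence
`ellAdicCohomology_limOneSequence` (Prop. 5.6.2) to two inputs on injective étale sheaves `I`:
(A) the étale acyclicity of `ν*(ulift I)` on `X_proét` (the affine content of the printed proof),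
and (B) `Hᵖ(X_ét, ulift I) = 0` for `p > 0`, where `ulift I = (uliftEtSheaf X).obj I` is `I` with
coefficients moved from `Ab.{u}` to `Ab.{u+1}` (the convention of `Scheme.EllAdicCohomology`).
This file **proves (B)** (`subsingleton_sheafH_uliftEtSheaf_of_injective`): `I` is Čech-acyclic
(Milne III 2.4), Čech exactness does not see the coefficient universe, and Cartan's criterion on
`X_ét` for all étale covers — every covering sieve of the small étale site contains a `u`-small
covering family (`exists_preZeroHypercover_le_of_mem_smallEtaleTopology`) — gives the vanishing
(`Literature.Algebra.Homology.subsingleton_sheafH_sheafCompose_uliftFunctor_of_injective`,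
`CechUniverseLift.lean`, `CartanCriterion.lean`). Hence Cor. 5.1.6 and Prop. 5.6.2 follow from (A)
alone (`nonempty_addEquiv_sheafH_etaleToProetPullback_of_etaleAcyclic'`,
`ellAdicCohomology_limOneSequence_of_etaleAcyclic'`).

## References

* B. Bhatt, P. Scholze, *The pro-étale topology for schemes*, Astérisque 369 (2015)
  (arXiv:1309.1198): Cor. 5.1.6 and its proof, Prop. 5.6.2. [BhattScholze2015]
* J. S. Milne, *Étale cohomology* (2025 reissue): III Lemma 2.4, III Prop. 2.12. [Milne2025]

## Design notes

* Only theorems; no named facts (D-0026). The universe bookkeeping (B) was an explicit hypothesis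
  `hb` of `nonempty_addEquiv_sheafH_etaleToProetPullback_of_etaleAcyclic`; it is discharged here, not
  restated.
* Instances: `Shv(X_ét, Ab.{u+1})` is Grothendieck abelian (`isGrothendieckAbelian_etaleSheaf`,
  `EtaleToProetLeray.lean`), `X.Etale` has finite limits (Mathlib), `HasSheafify _ Ab.{u}` comes
  from Mathlib's affine étale site.
* Mathlib searches: `Scheme.mem_smallGrothendieckTopology` (used), `Scheme.Cover` (index types in
  `Type u`). Nothing restated.
-/

open CategoryTheory Limits Opposite AlgebraicGeometry Literature.Algebra.Homology

namespace Literature.AlgebraicGeometry.Motives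

universe uu

/-- Every covering sieve of the small étale site contains a covering family indexed in `Type u`
(Mathlib `Scheme.mem_smallGrothendieckTopology`: a covering sieve contains the presieve of an
étale cover `𝒰`, whose index type is `u`-small). [folklore] -/
theorem exists_preZeroHypercover_le_of_mem_smallEtaleTopology (X : Scheme.{uu}) (U : X.Etale)
    (S₀ : Sieve U) (hS₀ : S₀ ∈ X.smallEtaleTopology U) :
    ∃ 𝒱 : PreZeroHypercover.{uu} U,
      Sieve.generate (Presieve.ofArrows 𝒱.X 𝒱.f) ∈ X.smallEtaleTopology U ∧ ∀ k, S₀ (𝒱.f k) := by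
  obtain ⟨𝒰, h𝒰, h, hle⟩ := (Scheme.mem_smallGrothendieckTopology U S₀).1 hS₀
  refine ⟨⟨𝒰.I₀, fun i => (𝒰.X i).asOverProp X (h i), fun i => (𝒰.f i).asOverProp X⟩, ?_,
    fun k => hle _ _ (Presieve.ofArrows.mk k)⟩
  exact (Scheme.mem_smallGrothendieckTopology U _).2 ⟨𝒰, h𝒰, h, Sieve.le_generate _⟩

/-- **Input (B) of the globalization of Bhatt–Scholze Cor. 5.1.6, proved: `Hᵖ(X_ét, ulift I) = 0`
for `p > 0` and `I` injective in `Shv(X_ét, Ab.{u})`**, where `ulift I ∈ Shv(X_ét, Ab.{u+1})` is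
the change of coefficient universe `uliftEtSheaf X` forced by the coefficient convention of
`Scheme.EllAdicCohomology`. `I` is Čech-acyclic (Milne III 2.4), Čech exactness does not see the
coefficient universe, and Cartan's criterion on `X_ét` for all étale covers gives the vanishing
(`Literature.Algebra.Homology.subsingleton_sheafH_sheafCompose_uliftFunctor_of_injective`).
[cite: Milne2025, III Prop. 2.12 and Lemma 2.4] -/
theorem subsingleton_sheafH_uliftEtSheaf_of_injective (X : Scheme.{uu})
    (I : Sheaf X.smallEtaleTopology Ab.{uu}) [Injective I] (q : ℕ) :
    Subsingleton (((uliftEtSheaf X).obj I).H (q + 1)) :=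
  subsingleton_sheafH_sheafCompose_uliftFunctor_of_injective.{uu + 1, uu, uu, uu + 1, uu + 1}
    (J := X.smallEtaleTopology) (exists_preZeroHypercover_le_of_mem_smallEtaleTopology X) I
    (isTerminalEtaleMkId X) q

/-- **Bhatt–Scholze Cor. 5.1.6 (`nonempty_addEquiv_sheafH_etaleToProetPullback`) from the étale
acyclicity (A) alone**: input (B) of `nonempty_addEquiv_sheafH_etaleToProetPullback_of_etaleAcyclic`
(`EtaleToProetLeray.lean`) is `subsingleton_sheafH_uliftEtSheaf_of_injective`. What remains is
(A): `ν*(ulift I)` is étale-acyclic on `X_proét` — the printed affine statement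
"`Hᵖ(U, ν*I) = 0` for `U ∈ X_proét^aff`" (Cartan's criterion over ind-étale covers, Thm. 2.3.4,
Lemma 5.1.1). [cite: BhattScholze2015, Cor. 5.1.6] -/
theorem nonempty_addEquiv_sheafH_etaleToProetPullback_of_etaleAcyclic'
    (ha : ∀ (X : Scheme.{uu}) (I : Sheaf X.smallEtaleTopology Ab.{uu}), Injective I →
      (etaleToProetPullbackULift X).obj I ∈ etaleAcyclic X) :
    nonempty_addEquiv_sheafH_etaleToProetPullback.{uu} :=
  nonempty_addEquiv_sheafH_etaleToProetPullback_of_etaleAcyclic ha fun X I hI q => by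
    haveI := hI
    exact subsingleton_sheafH_uliftEtSheaf_of_injective X I q

/-- **The `lim¹` sequence `ellAdicCohomology_limOneSequence` (Prop. 5.6.2) from (A) alone.**
[cite: BhattScholze2015, Prop. 5.6.2 and Cor. 5.1.6] -/
theorem ellAdicCohomology_limOneSequence_of_etaleAcyclic'
    (ha : ∀ (X : Scheme.{uu}) (I : Sheaf X.smallEtaleTopology Ab.{uu}), Injective I →
      (etaleToProetPullbackULift X).obj I ∈ etaleAcyclic X) :
    ellAdicCohomology_limOneSequence.{uu} :=
  ellAdicCohomology_limOneSequence_of_etaleAcyclic ha fun X I hI q => by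
    haveI := hI
    exact subsingleton_sheafH_uliftEtSheaf_of_injective X I q

end Literature.AlgebraicGeometry.Motives
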